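import Summits.HodgeConjecture.CorCM.MultiFieldWeilOcticSlotsDegreeForm
import HarnessLib

/-!
# MULTI-FIELD WEIL ENGINE — SLOTS LINEARLY DISJOINT FROM A GALOIS CLOSURE: stabiliser-transitivity INTO ANY slot from ONE degree; CM fourfolds of `k`-signature
# `(1,3)` over ARBITRARY octic CM fields (quartic part `C₄`, `V₄`, `D₄` allowed) join the sextic + octic + decic menu

Cell `pub-hodgecm2` (COR-CM), seat b30 gen 39 (2026-08-25); count-neutral own lane MULTI-FIELD WEIL ENGINE (stem `MultiFieldWeil*`), sequel of Z3
(`CorCM/MultiFieldWeilOcticSlotsHeadline.lean`: the menu `(3,1), (4,1), (4,2), (5,2)` with `2`-TRANSITIVE quartic part on every octic slot) and of gen 31's orbit counting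
(`CorCM/MultiFieldWeilOrbitCounting.lean`, `exists_ringEquiv_fix_comp_eq_comp_of_finrank`).  Theorems only; no definition, no named fact, no `sorry`.  HONEST FRAMING: the
headlines are conditional ONLY on the two displayed binders `Markman2025_weilClasses_algebraic_abelianFourfold` and `Markman2025_weilClasses_algebraic_hyperbolicSixfold`;
`HC_CM` is NOT proved and not asserted.

THE POINT (RUNBOOK-g38 ζ4).  Z3 needs, on every OCTIC slot, the realised tuples to be `2`-transitive (quartic part `𝔄₄`/`𝔖₄`): for the `(4,2)` slots this feeds the defect law
(`2`-homogeneity), but for the `(4,1)` slots (CM fourfolds of `k`-signature `(1,3)`, Markman's hyperbolic sixfold) the defect law needs NOTHING (`sep_of_card_one`), and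
`2`-transitivity was used only to get stabiliser-transitivity INTO the slot from a mover (Z2, primitivity).  For an IMPRIMITIVE quartic part (`C₄`, `V₄`, `D₄`) a mover is not
enough — the tuples trivial at `m₀` may have two orbits of size `2` (the fibres over the quadratic subfield `k ⊂ F ⊂ K_m` when `F ↪ L(K_{m₀})`).  The right hypothesis is
ONE DEGREE: `[L(K_{m₀})·s(K_m) : L(K_{m₀})] = [K_m : k]` for one `τ`-embedding `s` (equivalently, `L(K_{m₀})` being normal: `s(K_m) ∩ L(K_{m₀}) = τ(k)`, i.e. NO intermediate
field `k ⊊ F ⊆ K_m` embeds into `L(K_{m₀})` along `s`).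

§1 **STABILISER-TRANSITIVITY INTO ANY SLOT FROM ONE DEGREE** (`stabTransitive_realisedTuples_of_finrank_closure`, automorphism form `exists_aut_fix_comp_eq_of_finrank_closure`):
if `[L(K_{m₀}) ⊔ ℚ(s(K_m)) : ℚ] = [L(K_{m₀}) : ℚ] · n_m` for one `τ`-embedding `s` of `K_m`, then `Aut(ℂ/L(K_{m₀}))` is transitive on the `τ`-embeddings of `K_m` (orbit
counting with `M = L(K_{m₀})`), and its elements fix every `τ`-embedding of `K_{m₀}`: the realised tuples trivial at `m₀` are transitive on the slot `m` — ANY sizes, ANY groups.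
§2 **THE MENU WITH IMPRIMITIVE QUARTIC SLOTS** (`stabTransitive_realisedTuples_of_menu_imprimitive`): sizes `n_m ∈ {3, 4, 5}`, a flag `t m` on the size-`4` slots on which
the realised tuples are `2`-transitive; INTO an unflagged size-`4` slot: the degree hypothesis of §1; INTO the other slots: exactly Z3's menu (W1 ∕ Y2 ∕ Z2: a value outside the
closure for `n_{m₀} = n_m`, for `4 → 3`, nothing for `3 ↔ 5`, `3 → 4`, `5 → 4`, `4 → 5`).
§3 **HEADLINE `hodgeConjectureFor_biproduct_comp_of_sexticsOcticsDecics_imprimitive`**: `E` + any number of slots of types `(3,1)`, `(4,1)`, `(4,2)`, `(5,2)` over CM fields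
through `k`; the `(4,2)` slots and any flagged `(4,1)` slots with `2`-transitive `Aut(ℂ/τk)` on the `τ`-embeddings; the UNFLAGGED `(4,1)` slots — CM fourfolds of
`k`-signature `(1,3)` over octic CM fields with ARBITRARY quartic part — linearly disjoint from the other closures in the sense of §1; Z3's closure hypotheses for the other
pairs ⟹ HC for EVERY product of copies and everything dominated, GIVEN ONLY Markman's two theorems.  `…_of_isEmpty_ringHom`: `Hom = ∅` for the sextic and the decic pairs.
(Single such fourfolds with `E`: gens 18–21 `OcticCurveFourfold*`; here they sit in multi-field families.)

[cite: Lang2002, VI §1 Thm. 1.1, Cor. 1.6, Thm. 1.12 and V §2 Thm. 2.8] [cite: Shimura1998, §18.2 Lemma (i)] [cite: DixonMortimer1996, §1.5 (blocks), §1.6 Thm. 1.6A; §3.3, Thm. 3.3A]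
[cite: Markman2025SurveySecant, Thm. 1.2] [cite: Markman2025SecantWeil, Thm 1.5.1] [cite: Pohlmann1968, Thm 1] [cite: MoonenZarhin1995Duke, Thm. 2.4] [cite: MumfordAV1970, §19]
[cite: Dodson1984, §1.1 Imprimitivity Theorem and §5.1.2 Theorem]

## References
* [Lang2002] S. Lang, *Algebra*, GTM 211, V §2 Thm. 2.8, VI §1 Thm. 1.1, Cor. 1.6, Thm. 1.12 (linear disjointness from a Galois extension).  [Shimura1998] G. Shimura, *Abelian
  varieties with complex multiplication and modular functions*, §18.2 Lemma (i).  [DixonMortimer1996] J. D. Dixon, B. Mortimer, *Permutation Groups*, GTM 163, §1.5–§1.6, §3.3.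
* [Markman2025SurveySecant] E. Markman, arXiv:2509.23403, Thm. 1.2.  [Markman2025SecantWeil] E. Markman, Cycles on abelian 2n-folds of Weil type from secant sheaves on abelian
  n-folds, Thm 1.5.1.  [Pohlmann1968] H. Pohlmann, Ann. of Math. 88 (1968), Thm 1.  [MoonenZarhin1995Duke] B. Moonen, Yu. Zarhin, Duke Math. J. 77 (1995), Thm. 2.4.
  [MumfordAV1970] D. Mumford, *Abelian Varieties*, §19.  [Dodson1984] B. Dodson, Trans. AMS 283 (1984), §1.1, §5.1.2.
-/

noncomputable section

open CategoryTheory CategoryTheory.Limits NumberField IntermediateField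

namespace Summit.HodgeConjecture.CorCM.MultiFieldWeil

open Finset
open Literature.AlgebraicGeometry Literature.AlgebraicGeometry.Motives Literature.AlgebraicGeometry.HodgeTheory
open Literature.AlgebraicGeometry.ComplexMultiplication (IsCMTypeRealisation)
open Literature.AlgebraicTopology.SingularHomology
open Literature.NumberTheory.ComplexMultiplication
open Summit.HodgeConjecture.CorCM.Census.MultiFieldWeil

open scoped Classical

/-! ## §1 Stabiliser-transitivity INTO any slot from one degree over the Galois closure -/

section Realised

variable {I : Type} {r : ℕ} {Kf : I → Type} [∀ i, Field (Kf i)] [∀ i, NumberField (Kf i)] {i₀ : I} {is : Fin r → I} {n : Fin r → ℕ}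
  {e : ∀ m : Fin r, (Kf (is m) →+* ℂ) ≃ Fin (n m) × Bool} {τ : Kf i₀ →+* ℂ} {im : ∀ m : Fin r, Kf i₀ →+* Kf (is m)}
  (he_sign : ∀ (m : Fin r) (s : Kf (is m) →+* ℂ), (e m s).2 = true ↔ s.comp (im m) = τ)

include he_sign in
/-- **STABILISER-TRANSITIVITY INTO ANY SLOT FROM ONE DEGREE OVER THE GALOIS CLOSURE.**  `k = Kf i₀` imaginary quadratic, `[K_m : ℚ] = 2 n_m` along `i_m`; if for ONE `τ`-embedding
`s` of `K_m` the subfield `L(K_{m₀}) ⊔ ℚ(s(K_m))` of `ℂ` has degree `[L(K_{m₀}) : ℚ] · n_m` — `s(K_m)` linearly disjoint from the Galois closure `L(K_{m₀})` over `τ(k)` — then the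
realised tuples trivial at `m₀` are TRANSITIVE on the slot `m`: `Aut(ℂ/L(K_{m₀}))` reaches every `τ`-embedding of `K_m` (gen 31's orbit counting with `M = L(K_{m₀})`) and fixes every
embedding of `K_{m₀}`.  No hypothesis on the sizes or on the Galois groups. [cite: Lang2002, VI §1 Thm. 1.1, Cor. 1.6, Thm. 1.12 and V §2 Thm. 2.8] [cite: Shimura1998, §18.2 Lemma (i)] -/
theorem stabTransitive_realisedTuples_of_finrank_closure (h2 : Module.finrank ℚ (Kf i₀) = 2) (hdeg : ∀ l : Fin r, Module.finrank ℚ (Kf (is l)) = 2 * n l) (m₀ m : Fin r)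
    (hdisj : ∃ s : Kf (is m) →+* ℂ, s.comp (im m) = τ ∧ Module.finrank ℚ ↥(normalClosure ℚ (Kf (is m₀)) ℂ ⊔ adjoin ℚ (Set.range s)) =
      Module.finrank ℚ ↥(normalClosure ℚ (Kf (is m₀)) ℂ) * n m)
    (a a' : Fin (n m)) : ∃ ν ∈ realisedTuples e τ, ν m₀ = 1 ∧ ν m a = a' := by
  obtain ⟨s, hs, hd⟩ := hdisj
  set M : IntermediateField ℚ ℂ := normalClosure ℚ (Kf (is m₀)) ℂ with hM
  have hsl : ∀ (l : Fin r) (x : Fin (n l)), ((e l).symm (x, true)).comp (im l) = τ := fun l x => (he_sign l _).1 (by rw [Equiv.apply_symm_apply])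
  -- `τ(k) ⊆ M`: through a `τ`-embedding of `K_{m₀}`
  have hτM : ∀ x, τ x ∈ M := fun x => by
    have h0 : 0 < n m₀ := slot_pos_of_frame he_sign m₀
    rw [← hsl m₀ ⟨0, h0⟩, RingHom.comp_apply]
    exact ringHom_apply_mem_normalClosure _ _
  -- orbit counting with the one-member family `s`
  have hn : ∀ _j : Fin 1, (Finset.univ.filter fun u : Kf (is m) →+* ℂ => u.comp (im m) = τ).card = n m := fun _ =>
    SexticOcticWeil.card_filter_comp_eq_of_finrank (im m) (hdeg m) h2 τ
  have hU : (⋃ _j : Fin 1, Set.range s) = Set.range s := Set.iUnion_const _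
  have hd' : Module.finrank ℚ ↥(M ⊔ adjoin ℚ (⋃ _j : Fin 1, Set.range ((fun _ : Fin 1 => s) _j))) = Module.finrank ℚ M * ∏ _j : Fin 1, n m := by
    rw [Fin.prod_univ_one]
    exact (congrArg (fun S => Module.finrank ℚ ↥(M ⊔ adjoin ℚ S)) hU).trans hd
  obtain ⟨ρ, hρM, hρ⟩ := exists_ringEquiv_fix_comp_eq_comp_of_finrank (K := fun _ : Fin 1 => Kf (is m)) (i := fun _ => im m) M hτM (fun _ => s) (fun _ => hs)
    (fun _ => n m) hn hd' (fun _ => (e m).symm (a, true)) (fun _ => (e m).symm (a', true)) (fun _ => hsl m a) (fun _ => hsl m a')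
  have hρτ : (ρ : ℂ →+* ℂ).comp τ = τ := RingHom.ext fun y => hρM _ (hτM y)
  obtain ⟨π, hπ, hπρ⟩ := exists_mem_realisedTuples_of_comp_tau_eq (e := e) he_sign ρ hρτ
  refine ⟨π, hπ, ?_, ?_⟩
  · ext b
    have hfix : (ρ : ℂ →+* ℂ).comp ((e m₀).symm (b, true)) = (e m₀).symm (b, true) :=
      RingHom.ext fun y => hρM _ (ringHom_apply_mem_normalClosure _ y)
    have h := hπρ m₀ b
    rw [hfix] at h
    exact congrArg Fin.val (congrArg Prod.fst ((e m₀).symm.injective h)).symm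
  · have h := hπρ m a
    rw [hρ 0] at h
    exact (congrArg Prod.fst ((e m).symm.injective h)).symm

end Realised

/-! ## §1b The automorphism form -/

section Aut

variable {I : Type} {r : ℕ} {Kf : I → Type} [∀ i, Field (Kf i)] [∀ i, NumberField (Kf i)] [∀ i, IsCMField (Kf i)]
  {i₀ : I} {is : Fin r → I} {n : Fin r → ℕ} {τ : Kf i₀ →+* ℂ}

/-- **THE `hST` BINDER FROM ONE DEGREE OVER THE GALOIS CLOSURE** (automorphism form of §1, no frames): for all `τ`-embeddings `s₁, s₂` of `K_m` some automorphism of `ℂ` over `τ(k)`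
fixes every `τ`-embedding of `K_{m₀}` and carries `s₁` to `s₂`. [cite: Lang2002, VI §1 Thm. 1.1, Cor. 1.6, Thm. 1.12 and V §2 Thm. 2.8] [cite: Shimura1998, §18.2 Lemma (i)] -/
theorem exists_aut_fix_comp_eq_of_finrank_closure (h2 : Module.finrank ℚ (Kf i₀) = 2) (hdeg : ∀ l : Fin r, Module.finrank ℚ (Kf (is l)) = 2 * n l)
    (im : ∀ l : Fin r, Kf i₀ →+* Kf (is l)) (m₀ m : Fin r)
    (hdisj : ∃ s : Kf (is m) →+* ℂ, s.comp (im m) = τ ∧ Module.finrank ℚ ↥(normalClosure ℚ (Kf (is m₀)) ℂ ⊔ adjoin ℚ (Set.range s)) =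
      Module.finrank ℚ ↥(normalClosure ℚ (Kf (is m₀)) ℂ) * n m)
    (s₁ s₂ : Kf (is m) →+* ℂ) (hs₁ : s₁.comp (im m) = τ) (hs₂ : s₂.comp (im m) = τ) :
    ∃ ρ : ℂ ≃+* ℂ, (ρ : ℂ →+* ℂ).comp τ = τ ∧ (∀ u : Kf (is m₀) →+* ℂ, u.comp (im m₀) = τ → (ρ : ℂ →+* ℂ).comp u = u) ∧ (ρ : ℂ →+* ℂ).comp s₁ = s₂ := by
  have hττ : ComplexEmbedding.conjugate τ ≠ τ := QuarticCM.conjugate_ne τ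
  have hk : ∀ σ : Kf i₀ →+* ℂ, σ = τ ∨ σ = ComplexEmbedding.conjugate τ := fun σ => QuarticCM.eq_or_eq_conjugate_of_quadratic h2 τ σ
  have hfr : ∀ l : Fin r, ∃ e : (Kf (is l) →+* ℂ) ≃ Fin (n l) × Bool, (∀ t, (e t).2 = true ↔ t.comp (im l) = τ) ∧
      ∀ t, e (ComplexEmbedding.conjugate t) = ((e t).1, !(e t).2) := fun l => exists_signFrame (hdeg l) h2 (im l) hττ hk
  choose e he_sign _ using hfr
  have hsymm : ∀ (l : Fin r) (t : Kf (is l) →+* ℂ), t.comp (im l) = τ → (e l).symm ((e l t).1, true) = t := fun l t ht => by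
    rw [show ((e l t).1, true) = e l t from Prod.ext rfl ((he_sign l t).2 ht).symm, Equiv.symm_apply_apply]
  obtain ⟨ν, hν, hν₀, hνa⟩ := stabTransitive_realisedTuples_of_finrank_closure (e := e) he_sign h2 hdeg m₀ m hdisj (e m s₁).1 (e m s₂).1
  obtain ⟨ρ, hρτ, hρ⟩ := (mem_realisedTuples e τ ν).1 hν
  refine ⟨ρ, hρτ, fun u hu => ?_, ?_⟩
  · have h := hρ m₀ (e m₀ u).1
    rwa [hν₀, hsymm m₀ u hu, Equiv.Perm.one_apply, hsymm m₀ u hu] at h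
  · have h := hρ m (e m s₁).1
    rwa [hνa, hsymm m s₁ hs₁, hsymm m s₂ hs₂] at h

end Aut

/-! ## §2 The menu with imprimitive quartic slots -/

section Menu

variable {I : Type} {r : ℕ} {Kf : I → Type} [∀ i, Field (Kf i)] [∀ i, NumberField (Kf i)] {i₀ : I} {is : Fin r → I} {n : Fin r → ℕ}
  {e : ∀ m : Fin r, (Kf (is m) →+* ℂ) ≃ Fin (n m) × Bool} {τ : Kf i₀ →+* ℂ} {im : ∀ m : Fin r, Kf i₀ →+* Kf (is m)}
  (he_sign : ∀ (m : Fin r) (s : Kf (is m) →+* ℂ), (e m s).2 = true ↔ s.comp (im m) = τ)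

include he_sign in
/-- **STABILISER-TRANSITIVITY FOR THE MENU WITH IMPRIMITIVE QUARTIC SLOTS.**  Frames `e`; `n_m ∈ {3, 4, 5}`; a flag `t` on slots; the realised tuples `2`-transitive on every
FLAGGED slot of size `4`; INTO an UNFLAGGED slot `m` of size `4` (from any `m₀ ≠ m`) one `τ`-embedding with `[L(K_{m₀}) ⊔ ℚ(s(K_m)) : ℚ] = 4 [L(K_{m₀}) : ℚ]`; for the pairs
`m₀ ≠ m` with `n_{m₀} = n_m` or `(n_{m₀}, n_m) = (4, 3)`, the slot `m` flagged if of size `4`, one `τ`-embedding of `K_m` with a value outside `L(K_{m₀})`.  Then for ALL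
`m₀ ≠ m` the realised tuples trivial at `m₀` are transitive on the slot `m`. [cite: Lang2002, VI §1 Thm. 1.1, Cor. 1.6, Thm. 1.12] [cite: DixonMortimer1996, §1.6, Thm. 1.6A; §3.3, Thm. 3.3A]
[cite: Shimura1998, §18.2 Lemma (i)] -/
theorem stabTransitive_realisedTuples_of_menu_imprimitive (h2 : Module.finrank ℚ (Kf i₀) = 2) (hdeg : ∀ l : Fin r, Module.finrank ℚ (Kf (is l)) = 2 * n l)
    (hn : ∀ m, n m = 3 ∨ n m = 4 ∨ n m = 5) (t : Fin r → Prop)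
    (h2t : ∀ m, n m = 4 → t m → ∀ a b a' b' : Fin (n m), a ≠ b → a' ≠ b' → ∃ π ∈ realisedTuples e τ, π m a = a' ∧ π m b = b')
    (hout : ∀ (m₀ m : Fin r), m₀ ≠ m → (n m₀ = n m ∨ (n m₀ = 4 ∧ n m = 3)) → (n m = 4 → t m) →
      ∃ s : Kf (is m) →+* ℂ, s.comp (im m) = τ ∧ ∃ x, s x ∉ normalClosure ℚ (Kf (is m₀)) ℂ)
    (hdisj : ∀ (m₀ m : Fin r), m₀ ≠ m → n m = 4 → ¬ t m → ∃ s : Kf (is m) →+* ℂ, s.comp (im m) = τ ∧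
      Module.finrank ℚ ↥(normalClosure ℚ (Kf (is m₀)) ℂ ⊔ adjoin ℚ (Set.range s)) = Module.finrank ℚ ↥(normalClosure ℚ (Kf (is m₀)) ℂ) * n m)
    (m₀ m : Fin r) (hm : m₀ ≠ m) (a a' : Fin (n m)) : ∃ ν ∈ realisedTuples e τ, ν m₀ = 1 ∧ ν m a = a' := by
  rcases hn m with h3 | h4 | h5
  · -- into a slot of size `3`: from `3` or `4` by W1 (a value outside), from `5` by Y2
    have h34 : n m = 4 → t m := fun h => by omega
    rcases hn m₀ with h3₀ | h4₀ | h5₀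
    · exact stabTransitive_realisedTuples_of_outside_prime (e := e) he_sign m₀ m (by rw [h3]; exact Nat.prime_three) (hout m₀ m hm (Or.inl (h3₀.trans h3.symm)) h34) a a'
    · exact stabTransitive_realisedTuples_of_outside_prime (e := e) he_sign m₀ m (by rw [h3]; exact Nat.prime_three) (hout m₀ m hm (Or.inr ⟨h4₀, h3⟩) h34) a a'
    · exact stabTransitive_realisedTuples_of_sizes_three_five (e := e) he_sign m₀ m (Or.inl ⟨h5₀, h3⟩) a a'
  · by_cases htm : t m
    · -- into a FLAGGED slot of size `4`: Z3's menu (free from `3`, `5`; a value outside from `4`)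
      rcases hn m₀ with h3₀ | h4₀ | h5₀
      · exact stabTransitive_realisedTuples_into_four (e := e) he_sign m₀ m (Or.inl h3₀) h4 (h2t m h4 htm) a a'
      · exact stabTransitive_realisedTuples_of_outside_twoTransitive (e := e) he_sign m₀ m (h2t m h4 htm)
          (hout m₀ m hm (Or.inl (h4₀.trans h4.symm)) fun _ => htm) a a'
      · exact stabTransitive_realisedTuples_into_four (e := e) he_sign m₀ m (Or.inr h5₀) h4 (h2t m h4 htm) a a'
    · -- into an UNFLAGGED slot of size `4`: one degree over `L(K_{m₀})`
      exact stabTransitive_realisedTuples_of_finrank_closure (e := e) he_sign h2 hdeg m₀ m (hdisj m₀ m hm h4 htm) a a'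
  · -- into a slot of size `5`: from `3` by Y2, from `4` for free, from `5` by W1
    have h54 : n m = 4 → t m := fun h => by omega
    rcases hn m₀ with h3₀ | h4₀ | h5₀
    · exact stabTransitive_realisedTuples_of_sizes_three_five (e := e) he_sign m₀ m (Or.inr ⟨h3₀, h5⟩) a a'
    · exact stabTransitive_realisedTuples_into_five_of_four (e := e) he_sign m₀ m h4₀ h5 a a'
    · exact stabTransitive_realisedTuples_of_outside_prime (e := e) he_sign m₀ m (by rw [h5]; exact Nat.prime_five) (hout m₀ m hm (Or.inl (h5₀.trans h5.symm)) h54) a a'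

end Menu

/-! ## §3 The headline: imprimitive quartic parts on the `(4,1)` slots -/

section Headline

variable {I : Type} {r : ℕ} {Kf : I → Type} [∀ i, Field (Kf i)] [∀ i, NumberField (Kf i)] [∀ i, IsCMField (Kf i)]
  {i₀ : I} {is : Fin r → I} {τ : Kf i₀ →+* ℂ}
  {A : Fin (r + 1) → AbelianVariety ℂ} {Φ : ∀ j : Fin (r + 1), CMType (Kf (mfSlots i₀ is j))}
  {ι : ∀ j, 𝓞 (Kf (mfSlots i₀ is j)) →+* End (A j)}
  {θ : ∀ j, Kf (mfSlots i₀ is j) →+* Module.End ℂ (complexBetti (A j).X 1)}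

/-- **HEADLINE — SIMPLE CM THREEFOLDS (SEXTIC FIELDS), CM FOURFOLDS OF `k`-SIGNATURE `(1,3)` OVER ARBITRARY OCTIC FIELDS AND OF `k`-SIGNATURE `(2,2)` ∕ FLAGGED `(1,3)`
OVER OCTIC FIELDS WITH `2`-TRANSITIVE QUARTIC PART, `(2,3)`-FIVEFOLDS (DECIC FIELDS), ALL THROUGH `k`; GIVEN ONLY MARKMAN'S TWO THEOREMS.**  `k = Kf i₀` imaginary quadratic,
`E = A 0 ⊨ (k; {τ})`, `B_m = A (m+1) ⊨ (K_m; Φ (m+1))`, `[K_m : ℚ] = 2 n_m`, `(n_m, p_m) ∈ {(3,1), (4,1), (4,2), (5,2)}`; a flag `t` on the slots.  HYPOTHESES: (i) on every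
FLAGGED octic slot and on every `(4,2)` slot (those must be flagged) `Aut(ℂ/τk)` is `2`-transitive on the `τ`-embeddings; (ii) for `m₀ ≠ m` with `n_{m₀} = n_m` or
`(n_{m₀}, n_m) = (4,3)`, `m` flagged if octic, some `τ`-embedding of `K_m` takes some value outside `L(K_{m₀})`; (iii) for every UNFLAGGED octic slot `m` — a CM fourfold of
`k`-signature `(1,3)` over an octic CM field with ARBITRARY quartic part — and every `m₀ ≠ m`, one `τ`-embedding `s` of `K_m` with `[L(K_{m₀}) ⊔ ℚ(s(K_m)) : ℚ] = 4 [L(K_{m₀}) : ℚ]`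
(no field strictly between `k` and `K_m` embeds into `L(K_{m₀})` along `s`).  Then the Hodge conjecture holds for EVERY product of copies `E^a × ∏_m B_m^{b_m}`.  `HC_CM` is NOT
asserted.  NOT covered: `(2,2)`-fourfolds over `C₄`/`V₄`/`D₄`-octic fields (extra classes outside the span). [cite: Markman2025SurveySecant, Thm. 1.2] [cite: Markman2025SecantWeil, Thm 1.5.1]
[cite: Pohlmann1968, Thm 1] [cite: MoonenZarhin1995Duke, Thm. 2.4] [cite: Lang2002, VI §1 Thm. 1.1, Cor. 1.6, Thm. 1.12] [cite: DixonMortimer1996, §1.6, Thm. 1.6A; §3.3, Thm. 3.3A] -/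
theorem hodgeConjectureFor_biproduct_comp_of_sexticsOcticsDecics_imprimitive (hW4 : Markman2025_weilClasses_algebraic_abelianFourfold)
    (hM6 : Markman2025_weilClasses_algebraic_hyperbolicSixfold) (n p : Fin r → ℕ) (t : Fin r → Prop)
    (hnp : ∀ m, (n m = 3 ∧ p m = 1) ∨ (n m = 4 ∧ p m = 1) ∨ (n m = 4 ∧ p m = 2 ∧ t m) ∨ (n m = 5 ∧ p m = 2))
    {N : ℕ} (κ : Fin N → Fin (r + 1)) (h2 : Module.finrank ℚ (Kf i₀) = 2) (hdeg : ∀ m : Fin r, Module.finrank ℚ (Kf (is m)) = 2 * n m)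
    (im : ∀ m : Fin r, Kf i₀ →+* Kf (is m)) (hA : ∀ j, IsCMTypeRealisation (Φ j) (A j) (ι j) (θ j)) (hΨ : ∀ σ : Kf i₀ →+* ℂ, σ ∈ (Φ 0).1 ↔ σ = τ)
    (hp : ∀ m : Fin r, (Finset.univ.filter fun s : Kf (is m) →+* ℂ => s.comp (im m) = τ ∧ s ∈ (Φ m.succ).1).card = p m)
    (h2T : ∀ m : Fin r, n m = 4 → t m → ∀ s₁ s₂ s₁' s₂' : Kf (is m) →+* ℂ, s₁.comp (im m) = τ → s₂.comp (im m) = τ → s₁'.comp (im m) = τ →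
      s₂'.comp (im m) = τ → s₁ ≠ s₂ → s₁' ≠ s₂' → ∃ ρ : ℂ ≃+* ℂ, (ρ : ℂ →+* ℂ).comp τ = τ ∧ (ρ : ℂ →+* ℂ).comp s₁ = s₁' ∧ (ρ : ℂ →+* ℂ).comp s₂ = s₂')
    (hout : ∀ (m₀ m : Fin r), m₀ ≠ m → (n m₀ = n m ∨ (n m₀ = 4 ∧ n m = 3)) → (n m = 4 → t m) →
      ∃ s : Kf (is m) →+* ℂ, s.comp (im m) = τ ∧ ∃ x, s x ∉ normalClosure ℚ (Kf (is m₀)) ℂ)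
    (hdisj : ∀ (m₀ m : Fin r), m₀ ≠ m → n m = 4 → ¬ t m → ∃ s : Kf (is m) →+* ℂ, s.comp (im m) = τ ∧
      Module.finrank ℚ ↥(normalClosure ℚ (Kf (is m₀)) ℂ ⊔ adjoin ℚ (Set.range s)) = Module.finrank ℚ ↥(normalClosure ℚ (Kf (is m₀)) ℂ) * 4) :
    HodgeConjectureFor (⨁ fun j => A (κ j)).dim (⨁ fun j => A (κ j)).X := by
  obtain ⟨δ₀, d, hd, hδ₀⟩ := CyclicSextic.exists_sq_eq_neg_nat_of_isTotallyComplex (Kf i₀) h2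
  obtain ⟨δ, hδ, hτ⟩ := OcticCurveFourfold.exists_delta_of_mem h2 hd hδ₀ τ
  have hττ : ComplexEmbedding.conjugate τ ≠ τ := QuarticCM.conjugate_ne τ
  have hk : ∀ σ : Kf i₀ →+* ℂ, σ = τ ∨ σ = ComplexEmbedding.conjugate τ := fun σ => QuarticCM.eq_or_eq_conjugate_of_quadratic h2 τ σ
  have hfr : ∀ m : Fin r, ∃ e : (Kf (is m) →+* ℂ) ≃ Fin (n m) × Bool, (∀ s, (e s).2 = true ↔ s.comp (im m) = τ) ∧
      ∀ s, e (ComplexEmbedding.conjugate s) = ((e s).1, !(e s).2) := fun m => exists_signFrame (hdeg m) h2 (im m) hττ hk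
  choose e he_sign he_conj using hfr
  have hcard : ∀ m, (Finset.univ.filter fun a : Fin (n m) => (e m).symm (a, true) ∈ (Φ m.succ).1).card = p m := fun m =>
    (card_posSet (he_sign m) (Φ m.succ)).trans (hp m)
  have hnp' : ∀ m, (n m = 3 ∧ p m = 1) ∨ (n m = 4 ∧ p m = 1) ∨ (n m = 4 ∧ p m = 2) ∨ (n m = 5 ∧ p m = 2) := fun m => by
    rcases hnp m with h | h | ⟨h, h', -⟩ | h
    exacts [Or.inl h, Or.inr (Or.inl h), Or.inr (Or.inr (Or.inl ⟨h, h'⟩)), Or.inr (Or.inr (Or.inr h))]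
  have hn : ∀ m, n m = 3 ∨ n m = 4 ∨ n m = 5 := fun m => by
    rcases hnp' m with ⟨h, -⟩ | ⟨h, -⟩ | ⟨h, -⟩ | ⟨h, -⟩
    exacts [Or.inl h, Or.inr (Or.inl h), Or.inr (Or.inl h), Or.inr (Or.inr h)]
  have h2t : ∀ m, n m = 4 → t m → ∀ a b a' b' : Fin (n m), a ≠ b → a' ≠ b' → ∃ π ∈ realisedTuples e τ, π m a = a' ∧ π m b = b' := fun m h4 ht =>
    twoTransitive_realisedTuples_of_aut (e := e) he_sign m (h2T m h4 ht)
  refine hodgeConjectureFor_biproduct_comp_of_kind_frames (is := is) (n := n)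
    (fun m => Finset.univ.filter fun a : Fin (n m) => (e m).symm (a, true) ∈ (Φ m.succ).1) p hcard (fun m => ?_) (fun m => ?_) κ h2 im hτ hA e he_sign he_conj hΨ
    (fun m s => mem_iff_snd_eq_decide_mem_posSet (he_conj m) (Φ m.succ) s) (fun m => ?_)
    (stabTransitive_realisedTuples_of_menu_imprimitive he_sign h2 hdeg hn t h2t hout fun m₀ m hm h4 ht => by rw [h4]; exact hdisj m₀ m hm h4 ht) fun m => ?_
  · rcases hnp' m with ⟨-, h⟩ | ⟨-, h⟩ | ⟨-, h⟩ | ⟨-, h⟩ <;> rw [h] <;> norm_num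
  · rcases hnp' m with ⟨h, h'⟩ | ⟨h, h'⟩ | ⟨h, h'⟩ | ⟨h, h'⟩ <;> rw [h, h'] <;> norm_num
  · rcases hnp m with ⟨h, -⟩ | ⟨-, h'⟩ | ⟨h, h', ht⟩ | ⟨h, -⟩
    · exact Or.inl (by rw [h]; exact Nat.prime_three)
    · exact Or.inr (Or.inl h')
    · have hhom := homogeneous_two_of_twoTransitive (R := realisedTuples e τ)
        (P := fun m => Finset.univ.filter fun a : Fin (n m) => (e m).symm (a, true) ∈ (Φ m.succ).1) (m := m) (by rw [hcard m, h']) (h2t m h ht)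
      exact Or.inr (Or.inr fun Q hQ => hhom Q (by rw [hQ, hcard m]))
    · exact Or.inl (by rw [h]; exact Nat.prime_five)
  · exact weilHyp_of_markman_intrinsic hW4 hM6 m (hnp' m) (hdeg m) h2 hd hδ hA hΨ (hp m)

/-- **Dominated form.** [cite: Markman2025SurveySecant, Thm. 1.2] [cite: Markman2025SecantWeil, Thm 1.5.1] [cite: MumfordAV1970, §19] -/
theorem hodgeConjectureFor_of_avDominatedBy_comp_of_sexticsOcticsDecics_imprimitive (hW4 : Markman2025_weilClasses_algebraic_abelianFourfold)
    (hM6 : Markman2025_weilClasses_algebraic_hyperbolicSixfold) (n p : Fin r → ℕ) (t : Fin r → Prop)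
    (hnp : ∀ m, (n m = 3 ∧ p m = 1) ∨ (n m = 4 ∧ p m = 1) ∨ (n m = 4 ∧ p m = 2 ∧ t m) ∨ (n m = 5 ∧ p m = 2))
    {N : ℕ} (κ : Fin N → Fin (r + 1)) (h2 : Module.finrank ℚ (Kf i₀) = 2) (hdeg : ∀ m : Fin r, Module.finrank ℚ (Kf (is m)) = 2 * n m)
    (im : ∀ m : Fin r, Kf i₀ →+* Kf (is m)) (hA : ∀ j, IsCMTypeRealisation (Φ j) (A j) (ι j) (θ j)) (hΨ : ∀ σ : Kf i₀ →+* ℂ, σ ∈ (Φ 0).1 ↔ σ = τ)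
    (hp : ∀ m : Fin r, (Finset.univ.filter fun s : Kf (is m) →+* ℂ => s.comp (im m) = τ ∧ s ∈ (Φ m.succ).1).card = p m)
    (h2T : ∀ m : Fin r, n m = 4 → t m → ∀ s₁ s₂ s₁' s₂' : Kf (is m) →+* ℂ, s₁.comp (im m) = τ → s₂.comp (im m) = τ → s₁'.comp (im m) = τ →
      s₂'.comp (im m) = τ → s₁ ≠ s₂ → s₁' ≠ s₂' → ∃ ρ : ℂ ≃+* ℂ, (ρ : ℂ →+* ℂ).comp τ = τ ∧ (ρ : ℂ →+* ℂ).comp s₁ = s₁' ∧ (ρ : ℂ →+* ℂ).comp s₂ = s₂')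
    (hout : ∀ (m₀ m : Fin r), m₀ ≠ m → (n m₀ = n m ∨ (n m₀ = 4 ∧ n m = 3)) → (n m = 4 → t m) →
      ∃ s : Kf (is m) →+* ℂ, s.comp (im m) = τ ∧ ∃ x, s x ∉ normalClosure ℚ (Kf (is m₀)) ℂ)
    (hdisj : ∀ (m₀ m : Fin r), m₀ ≠ m → n m = 4 → ¬ t m → ∃ s : Kf (is m) →+* ℂ, s.comp (im m) = τ ∧
      Module.finrank ℚ ↥(normalClosure ℚ (Kf (is m₀)) ℂ ⊔ adjoin ℚ (Set.range s)) = Module.finrank ℚ ↥(normalClosure ℚ (Kf (is m₀)) ℂ) * 4)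
    {X : AbelianVariety ℂ} (hX : Domination.AVDominatedBy X (⨁ fun j => A (κ j))) : HodgeConjectureFor X.dim X.X :=
  Domination.hodgeConjectureFor_of_avDominatedBy
    (hodgeConjectureFor_biproduct_comp_of_sexticsOcticsDecics_imprimitive hW4 hM6 n p t hnp κ h2 hdeg im hA hΨ hp h2T hout hdisj) hX

end Headline

end Summit.HodgeConjecture.CorCM.MultiFieldWeil

end
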